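/-
Copyright (c) 2026. All rights reserved.
Released under Apache 2.0 license as described in the file LICENSE.
-/
import Summits.AtomisticToContinuum.Crystallization.Theorems.OverbindingBudgetAffineFarStraighteningSnap
import Summits.AtomisticToContinuum.Crystallization.Theorems.OverbindingBudgetAffineFarStraighteningCompatCert

/-!
# Overbinding budget — R_aff′ brick COMPAT: snapped readings of adjacent sites have no near-misses

Slot Z of `stmt-AtomisticToContinuum-31280`, leaf `…FarSmoothSplit.AffineChartStraightening'` (R_aff′), brick R1d of the radial
development (g59 memo §3, §4 invariant (I1)).  Two adjacent framed sites with two-shell patterns `P ∋ e` and `P' ∋ f` whose six shared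
points are relabelled by a linear ISOMETRY `U` with `IsSnap P P' e f U` (brick SNAP, `snapRigidity_holds`) carry the exact readings
`insert 0 P` (around the first site) and `e + U (insert 0 P')` (around the second).  **COMPAT**: two read points at distance `< 1`
coincide (`snapCompatibility_holds`).  In the development this turns «the physical readings of a site through two adjacent placed
neighbours agree to `O(ρ²ε₁) < 1`» into «its two exact positions are EQUAL».

Proof.  Integer certificate `…FarStraighteningCompatCert` (kernel `decide`, 1368 snaps) + transport: for the chosen independent pair
`c₁, c₂` of the common shell of `f` with images `dᵢ = U cᵢ + e`, the decomposition `8N(u − e) = 8A₀ e + K₁(2d₁ − e) + K₂(2d₂ − e)`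
(certified coordinatewise) rewrites through `e = −U f`, `2dᵢ − e = U(2cᵢ − f)` as `8N(u − e) = U z`, so that
`dist (u, e + U u') = ‖(8N)⁻¹ z − u'‖ = √(‖z − 8N u'‖²_ℤ / (64 N² N'))`, and the certificate says this is `0` or `≥ 1`.
The only inputs about `U` are `IsSnap` and `‖U x‖ = ‖x‖`; the Gram and full-snap side conditions of the certificate follow from
`⟪U x + e, U y + e⟫ = ⟪x, y⟫` for `x, y` in the common shell of `f` (`inner_snapImage`).
-/

namespace Summit.AtomisticToContinuum.Crystallization.Theorems.OverbindingBudgetAffineFarSmoothSplit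

open scoped BigOperators RealInnerProductSpace
open Literature.Geometry.DiscreteGeometry (fccTwoShellPattern hcpTwoShellPattern scaledPattern intVec intVec_apply intVec_sub
  norm_intVec sqNormInt fccInt hcpInt fccSecondShellInt hcpSecondShellInt sqNormInt_fccInt sqNormInt_hcpInt)

/-! ## §1  The brick -/

/-- **R1d · PAIR COMPATIBILITY (no near-misses).**  For an isometric snap `U` of the adjacent pair `(e ∈ P, f ∈ P')`, the two exact
readings `insert 0 P` and `e + U (insert 0 P')` have no two distinct points at distance `< 1`. [this file; g59 memo §3 R1d] -/
def SnapCompatibility : Prop :=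
  ∀ (P P' : Finset (EuclideanSpace ℝ (Fin 3))), (P = fccTwoShellPattern ∨ P = hcpTwoShellPattern) →
    (P' = fccTwoShellPattern ∨ P' = hcpTwoShellPattern) → ∀ e ∈ P, ‖e‖ = 1 → ∀ f ∈ P', ‖f‖ = 1 →
      ∀ (U : EuclideanSpace ℝ (Fin 3) →ₗᵢ[ℝ] EuclideanSpace ℝ (Fin 3)), IsSnap P P' e f U.toLinearMap →
        ∀ u ∈ insert (0 : EuclideanSpace ℝ (Fin 3)) P, ∀ u' ∈ insert (0 : EuclideanSpace ℝ (Fin 3)) P',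
          dist u (e + U u') < 1 → u = e + U u'

/-! ## §2  Transport lemmas -/

-- `intVec_zero_fin3` is landed elsewhere (gate dedup); inlined below.

/-- A point of `insert 0 (scaledPattern T N)` is a scaled integer vector of `insert 0 T`. [this file] -/
theorem exists_int_of_mem_insert {T : Finset (Fin 3 → ℤ)} {N : ℕ} {u : EuclideanSpace ℝ (Fin 3)}
    (hu : u ∈ insert (0 : EuclideanSpace ℝ (Fin 3)) (scaledPattern T N)) :
    ∃ zu ∈ insert (0 : Fin 3 → ℤ) T, u = (Real.sqrt N)⁻¹ • intVec zu := by
  rcases Finset.mem_insert.1 hu with rfl | hu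
  · exact ⟨0, Finset.mem_insert_self _ _, by rw [show intVec (0 : Fin 3 → ℤ) = 0 from by ext i; simp [intVec], smul_zero]⟩
  · obtain ⟨zu, hzu, rfl⟩ := Finset.mem_image.1 hu
    exact ⟨zu, Finset.mem_insert_of_mem hzu, rfl⟩

/-- Snapped images keep inner products: `⟪U x + e, U y + e⟫ = ⟪x, y⟫` when `U f = −e`, `‖e‖ = 1`, `⟪x,f⟫ = ⟪y,f⟫ = 1/2`. [this file] -/
theorem inner_snapImage (U : EuclideanSpace ℝ (Fin 3) →ₗᵢ[ℝ] EuclideanSpace ℝ (Fin 3)) {e f x y : EuclideanSpace ℝ (Fin 3)}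
    (hUf : U f = -e) (he1 : ‖e‖ = 1) (hx : ⟪x, f⟫ = 1 / 2) (hy : ⟪y, f⟫ = 1 / 2) : ⟪U x + e, U y + e⟫ = ⟪x, y⟫ := by
  have he : e = -U f := by rw [hUf, neg_neg]
  have hxe : ⟪U x, e⟫ = -(1 / 2) := by rw [he, inner_neg_right, LinearIsometry.inner_map_map, hx]
  have hey : ⟪e, U y⟫ = -(1 / 2) := by rw [he, inner_neg_left, LinearIsometry.inner_map_map, real_inner_comm y f, hy]
  have hee : ⟪e, e⟫ = 1 := by rw [real_inner_self_eq_norm_sq, he1, one_pow]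
  rw [inner_add_left, inner_add_right, inner_add_right, LinearIsometry.inner_map_map, hxe, hey, hee]
  ring

/-- Equal inner products of scaled integer vectors give the cross-multiplied integer identity. [this file] -/
theorem int_eq_of_inner_scaled_eq {N N' : ℕ} (hN : N ≠ 0) (hN' : N' ≠ 0) {a b c d : Fin 3 → ℤ}
    (h : ⟪(Real.sqrt N)⁻¹ • intVec a, (Real.sqrt N)⁻¹ • intVec b⟫ =
      ⟪(Real.sqrt N')⁻¹ • intVec c, (Real.sqrt N')⁻¹ • intVec d⟫) :
    (N' : ℤ) * dotInt a b = N * dotInt c d := by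
  have hNpos : (0 : ℝ) < (N : ℝ) := by exact_mod_cast Nat.pos_of_ne_zero hN
  have hN'pos : (0 : ℝ) < (N' : ℝ) := by exact_mod_cast Nat.pos_of_ne_zero hN'
  have hsN : ((Real.sqrt N)⁻¹) ^ 2 = (N : ℝ)⁻¹ := by rw [inv_pow, Real.sq_sqrt hNpos.le]
  have hsN' : ((Real.sqrt N')⁻¹) ^ 2 = (N' : ℝ)⁻¹ := by rw [inv_pow, Real.sq_sqrt hN'pos.le]
  rw [inner_scaled_scaled, inner_scaled_scaled, hsN, hsN'] at h
  have hN0 : (N : ℝ) ≠ 0 := hNpos.ne'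
  have hN'0 : (N' : ℝ) ≠ 0 := hN'pos.ne'
  have h2 : (N' : ℝ) * (dotInt a b : ℝ) = (N : ℝ) * (dotInt c d : ℝ) := by
    field_simp at h
    linarith
  exact_mod_cast h2

/-- **COMPAT on the integer models.**  The certificate `SnapCompatAt` at every label, transported. [this file] -/
theorem snapCompat_scaled {S S₂ S' S₂' : Finset (Fin 3 → ℤ)} {N N' : ℕ} (hN : N ≠ 0) (hN' : N' ≠ 0)
    (hSnorm' : ∀ z ∈ S', sqNormInt z = N')
    (hfirst : ∀ z ∈ S ∪ S₂, sqNormInt z = N → z ∈ S) (hfirst' : ∀ z ∈ S' ∪ S₂', sqNormInt z = N' → z ∈ S')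
    (hcert : ∀ zf ∈ S', SnapCompatAt S S₂ N S' S₂' N' zf)
    {e f : EuclideanSpace ℝ (Fin 3)} (he : e ∈ scaledPattern (S ∪ S₂) N) (he1 : ‖e‖ = 1)
    (hf : f ∈ scaledPattern (S' ∪ S₂') N') (hf1 : ‖f‖ = 1)
    (U : EuclideanSpace ℝ (Fin 3) →ₗᵢ[ℝ] EuclideanSpace ℝ (Fin 3))
    (hU : IsSnap (scaledPattern (S ∪ S₂) N) (scaledPattern (S' ∪ S₂') N') e f U.toLinearMap)
    {u u' : EuclideanSpace ℝ (Fin 3)} (hu : u ∈ insert (0 : EuclideanSpace ℝ (Fin 3)) (scaledPattern (S ∪ S₂) N))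
    (hu' : u' ∈ insert (0 : EuclideanSpace ℝ (Fin 3)) (scaledPattern (S' ∪ S₂') N')) (hlt : dist u (e + U u') < 1) :
    u = e + U u' := by
  obtain ⟨hUf, hUsh⟩ := hU
  simp only [LinearIsometry.coe_toLinearMap] at hUf hUsh
  have hNpos : (0 : ℝ) < (N : ℝ) := by exact_mod_cast Nat.pos_of_ne_zero hN
  have hN'pos : (0 : ℝ) < (N' : ℝ) := by exact_mod_cast Nat.pos_of_ne_zero hN'
  have hN0 : (N : ℝ) ≠ 0 := hNpos.ne'
  have hN'0 : (N' : ℝ) ≠ 0 := hN'pos.ne'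
  have hsN' : ((Real.sqrt N')⁻¹) ^ 2 = (N' : ℝ)⁻¹ := by rw [inv_pow, Real.sq_sqrt hN'pos.le]
  obtain ⟨ze, hze, rfl⟩ := Finset.mem_image.1 he
  have hzeS : ze ∈ S := hfirst ze hze (sqNormInt_eq_of_norm_scaled_eq_one hN he1)
  obtain ⟨zf, hzf, rfl⟩ := Finset.mem_image.1 hf
  have hzfS : zf ∈ S' := hfirst' zf hzf (sqNormInt_eq_of_norm_scaled_eq_one hN' hf1)
  obtain ⟨zu, hzu, rfl⟩ := exists_int_of_mem_insert hu
  obtain ⟨zu', hzu', rfl⟩ := exists_int_of_mem_insert hu'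
  obtain ⟨c₁, hc₁S, c₂, hc₂S, hc₁f, hc₂f, -, hcore⟩ := hcert zf hzfS
  -- the common shell of `f`, realised
  have hsh : ∀ c ∈ S', sqNormInt (c - zf) = N' →
      InCommonShell (scaledPattern (S' ∪ S₂') N') ((Real.sqrt N')⁻¹ • intVec zf) ((Real.sqrt N')⁻¹ • intVec c) :=
    fun c hc hcf => ⟨Finset.mem_image_of_mem _ (Finset.mem_union_left _ hc), norm_scaled_eq_one hN' (hSnorm' c hc),
      by rw [← dist_eq_norm]; exact dist_scaled_eq_one hN' hcf⟩
  have hhalf : ∀ c, InCommonShell (scaledPattern (S' ∪ S₂') N') ((Real.sqrt N')⁻¹ • intVec zf) c →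
      ⟪c, (Real.sqrt N')⁻¹ • intVec zf⟫ = 1 / 2 := fun c hc => real_inner_eq_half hc.2.1 hf1 hc.2.2
  have hC₁ := hsh c₁ hc₁S hc₁f
  have hC₂ := hsh c₂ hc₂S hc₂f
  obtain ⟨zd₁, hzd₁S, hd₁, hd₁e⟩ := exists_int_of_inCommonShell hN hfirst (hUsh _ hC₁)
  obtain ⟨zd₂, hzd₂S, hd₂, hd₂e⟩ := exists_int_of_inCommonShell hN hfirst (hUsh _ hC₂)
  -- Gram match and the full-snap side condition
  have hgram : (N' : ℤ) * dotInt zd₁ zd₂ = N * dotInt c₁ c₂ := by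
    apply int_eq_of_inner_scaled_eq hN hN'
    rw [← hd₁, ← hd₂, inner_snapImage U hUf he1 (hhalf _ hC₁) (hhalf _ hC₂)]
  have hall : ∀ c' ∈ S', sqNormInt (c' - zf) = N' → ∃ d ∈ S, sqNormInt (d - ze) = N ∧
      (N' : ℤ) * dotInt d zd₁ = N * dotInt c' c₁ ∧ (N' : ℤ) * dotInt d zd₂ = N * dotInt c' c₂ := by
    intro c' hc'S hc'f
    have hC' := hsh c' hc'S hc'f
    obtain ⟨zd, hzdS, hd, hde⟩ := exists_int_of_inCommonShell hN hfirst (hUsh _ hC')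
    refine ⟨zd, hzdS, hde, ?_, ?_⟩
    · apply int_eq_of_inner_scaled_eq hN hN'
      rw [← hd, ← hd₁, inner_snapImage U hUf he1 (hhalf _ hC') (hhalf _ hC₁)]
    · apply int_eq_of_inner_scaled_eq hN hN'
      rw [← hd, ← hd₂, inner_snapImage U hUf he1 (hhalf _ hC') (hhalf _ hC₂)]
  obtain ⟨hdec, hpairs⟩ := hcore ze hzeS zd₁ hzd₁S zd₂ hzd₂S hd₁e hd₂e hgram hall zu hzu
  have hpair := hpairs zu' hzu'
  -- the decomposition, realised: `8N (u − e) = U ẑ`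
  have hUc₁ : U ((Real.sqrt N')⁻¹ • intVec c₁) = (Real.sqrt N)⁻¹ • intVec zd₁ - (Real.sqrt N)⁻¹ • intVec ze := by
    rw [← hd₁, add_sub_cancel_right]
  have hUc₂ : U ((Real.sqrt N')⁻¹ • intVec c₂) = (Real.sqrt N)⁻¹ • intVec zd₂ - (Real.sqrt N)⁻¹ • intVec ze := by
    rw [← hd₂, add_sub_cancel_right]
  have hdecR : (8 * (N : ℝ)) • ((Real.sqrt N)⁻¹ • intVec zu - (Real.sqrt N)⁻¹ • intVec ze) =
      (8 * (snapA0 N ze zu : ℝ)) • ((Real.sqrt N)⁻¹ • intVec ze) +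
        (snapK N ze zd₁ zd₂ zu : ℝ) • ((2 : ℝ) • ((Real.sqrt N)⁻¹ • intVec zd₁) - (Real.sqrt N)⁻¹ • intVec ze) +
        (snapK N ze zd₂ zd₁ zu : ℝ) • ((2 : ℝ) • ((Real.sqrt N)⁻¹ • intVec zd₂) - (Real.sqrt N)⁻¹ • intVec ze) := by
    ext i
    have hi : ((8 * (N : ℤ) * (zu i - ze i) : ℤ) : ℝ) = ((8 * snapA0 N ze zu * ze i +
        snapK N ze zd₁ zd₂ zu * (2 * zd₁ i - ze i) + snapK N ze zd₂ zd₁ zu * (2 * zd₂ i - ze i) : ℤ) : ℝ) := by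
      exact_mod_cast hdec i
    push_cast at hi
    simp only [PiLp.add_apply, PiLp.sub_apply, PiLp.smul_apply, smul_eq_mul, intVec_apply]
    linear_combination (Real.sqrt N)⁻¹ * hi
  have hz : (Real.sqrt N')⁻¹ • intVec (snapZ N ze zd₁ zd₂ zu zf c₁ c₂) =
      (-(8 * (snapA0 N ze zu : ℝ))) • ((Real.sqrt N')⁻¹ • intVec zf) +
        (snapK N ze zd₁ zd₂ zu : ℝ) • ((2 : ℝ) • ((Real.sqrt N')⁻¹ • intVec c₁) - (Real.sqrt N')⁻¹ • intVec zf) +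
        (snapK N ze zd₂ zd₁ zu : ℝ) • ((2 : ℝ) • ((Real.sqrt N')⁻¹ • intVec c₂) - (Real.sqrt N')⁻¹ • intVec zf) := by
    ext i
    simp only [PiLp.add_apply, PiLp.sub_apply, PiLp.smul_apply, smul_eq_mul, intVec_apply, snapZ]
    push_cast
    ring
  have hUz : U ((Real.sqrt N')⁻¹ • intVec (snapZ N ze zd₁ zd₂ zu zf c₁ c₂)) =
      (8 * (N : ℝ)) • ((Real.sqrt N)⁻¹ • intVec zu - (Real.sqrt N)⁻¹ • intVec ze) := by
    rw [hdecR, hz]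
    simp only [map_add, map_sub, LinearIsometry.map_smul, hUf, hUc₁, hUc₂]
    module
  have h8N : (8 * (N : ℝ)) ≠ 0 := by positivity
  have hdiff : (Real.sqrt N)⁻¹ • intVec zu - ((Real.sqrt N)⁻¹ • intVec ze + U ((Real.sqrt N')⁻¹ • intVec zu')) =
      U ((8 * (N : ℝ))⁻¹ • ((Real.sqrt N')⁻¹ • intVec (snapZ N ze zd₁ zd₂ zu zf c₁ c₂)) - (Real.sqrt N')⁻¹ • intVec zu') := by
    have hsm : U ((8 * (N : ℝ))⁻¹ • ((Real.sqrt N')⁻¹ • intVec (snapZ N ze zd₁ zd₂ zu zf c₁ c₂))) =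
        (8 * (N : ℝ))⁻¹ • U ((Real.sqrt N')⁻¹ • intVec (snapZ N ze zd₁ zd₂ zu zf c₁ c₂)) := LinearIsometry.map_smul _ _ _
    rw [map_sub, hsm, hUz, smul_smul, inv_mul_cancel₀ h8N, one_smul]
    abel
  -- the integer difference vector
  have hw : (8 * (N : ℝ))⁻¹ • ((Real.sqrt N')⁻¹ • intVec (snapZ N ze zd₁ zd₂ zu zf c₁ c₂)) - (Real.sqrt N')⁻¹ • intVec zu' =
      ((Real.sqrt N')⁻¹ * (8 * (N : ℝ))⁻¹) • intVec (fun i => snapZ N ze zd₁ zd₂ zu zf c₁ c₂ i - 8 * N * zu' i) := by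
    ext i
    simp only [PiLp.sub_apply, PiLp.smul_apply, smul_eq_mul, intVec_apply]
    push_cast
    field_simp
  have hd2 : dist ((Real.sqrt N)⁻¹ • intVec zu) ((Real.sqrt N)⁻¹ • intVec ze + U ((Real.sqrt N')⁻¹ • intVec zu')) ^ 2 =
      (sqNormInt (fun i => snapZ N ze zd₁ zd₂ zu zf c₁ c₂ i - 8 * N * zu' i) : ℝ) / (64 * (N : ℝ) ^ 2 * N') := by
    rw [dist_eq_norm, hdiff, LinearIsometry.norm_map, hw, norm_smul, norm_intVec, mul_pow,
      Real.sq_sqrt (show (0 : ℝ) ≤ (sqNormInt _ : ℝ) by unfold sqNormInt; push_cast; positivity), Real.norm_of_nonneg (by positivity), mul_pow, hsN']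
    field_simp
    ring
  rcases hpair with hzero | hbig
  · -- the two readings coincide
    have h0 : intVec (fun i => snapZ N ze zd₁ zd₂ zu zf c₁ c₂ i - 8 * N * zu' i) = 0 := by
      ext i; simp [intVec, hzero i]
    have : (Real.sqrt N)⁻¹ • intVec zu - ((Real.sqrt N)⁻¹ • intVec ze + U ((Real.sqrt N')⁻¹ • intVec zu')) = 0 := by
      rw [hdiff, hw, h0, smul_zero, map_zero]
    exact sub_eq_zero.1 this
  · -- they are `≥ 1` apart: contradiction
    exfalso
    have hbigR : (64 * (N : ℝ) ^ 2 * N' : ℝ) ≤ (sqNormInt (fun i => snapZ N ze zd₁ zd₂ zu zf c₁ c₂ i - 8 * N * zu' i) : ℝ) := by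
      exact_mod_cast hbig
    have h1 : (1 : ℝ) ≤ dist ((Real.sqrt N)⁻¹ • intVec zu)
        ((Real.sqrt N)⁻¹ • intVec ze + U ((Real.sqrt N')⁻¹ • intVec zu')) ^ 2 := by
      rw [hd2, le_div_iff₀ (by positivity), one_mul]
      exact hbigR
    have h0 := dist_nonneg (x := (Real.sqrt N)⁻¹ • intVec zu)
      (y := (Real.sqrt N)⁻¹ • intVec ze + U ((Real.sqrt N')⁻¹ • intVec zu'))
    nlinarith

/-! ## §3  The brick, proved -/

/-- **R1d · PAIR COMPATIBILITY holds.** [this file; g59 memo §3 R1d] -/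
theorem snapCompatibility_holds : SnapCompatibility := by
  intro P P' hP hP' e he he1 f hf hf1 U hU u hu u' hu' hlt
  have hSf : ∀ z ∈ fccInt, sqNormInt z = ((2 : ℕ) : ℤ) := sqNormInt_fccInt
  have hSh : ∀ z ∈ hcpInt, sqNormInt z = ((18 : ℕ) : ℤ) := sqNormInt_hcpInt
  rcases hP with rfl | rfl <;> rcases hP' with rfl | rfl
  · exact snapCompat_scaled two_ne_zero two_ne_zero hSf (by exact_mod_cast mem_fccInt_of_sqNormInt)
      (by exact_mod_cast mem_fccInt_of_sqNormInt) (by exact_mod_cast snapCompatAt_fcc_fcc) he he1 hf hf1 U hU hu hu' hlt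
  · exact snapCompat_scaled two_ne_zero (by norm_num) hSh (by exact_mod_cast mem_fccInt_of_sqNormInt)
      (by exact_mod_cast mem_hcpInt_of_sqNormInt) (by exact_mod_cast snapCompatAt_fcc_hcp) he he1 hf hf1 U hU hu hu' hlt
  · exact snapCompat_scaled (by norm_num) two_ne_zero hSf (by exact_mod_cast mem_hcpInt_of_sqNormInt)
      (by exact_mod_cast mem_fccInt_of_sqNormInt) (by exact_mod_cast snapCompatAt_hcp_fcc) he he1 hf hf1 U hU hu hu' hlt
  · exact snapCompat_scaled (by norm_num) (by norm_num) hSh (by exact_mod_cast mem_hcpInt_of_sqNormInt)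
      (by exact_mod_cast mem_hcpInt_of_sqNormInt) (by exact_mod_cast snapCompatAt_hcp_hcp) he he1 hf hf1 U hU hu hu' hlt

end Summit.AtomisticToContinuum.Crystallization.Theorems.OverbindingBudgetAffineFarSmoothSplit
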